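import Mathlib
import HarnessLib
import Summits.HubbardSuperconductivity.HubbardSuperconductivity.Theses.WeakCouplingBCS
import Summits.HubbardSuperconductivity.HubbardSuperconductivity.Theorems.WeakCouplingBCSH1TwoPointLimitKLScaleDPlumbing
import Summits.HubbardSuperconductivity.HubbardSuperconductivity.Theorems.WeakCouplingBCSH1TwoPointLimitKLScaleDFillings
import Summits.HubbardSuperconductivity.HubbardSuperconductivity.Theorems.WeakCouplingBCSWcbcsBcsConstructionThinSufficiency

/-!
# Route `WeakCouplingBCS` (ladder H3) — the DOOR from rung R2d (certificate half ∧ leaf `H1TwoPointLimitKLScaleD`) to crux 4's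
# registered research stub, the thin crux and the summit: what the Kohn–Luttinger pair buys, and what remains, BY NAME

Cell `gate-hubbard-kl`, seat `hubbard-kl-h1-p1` (row «R2dH1 leaf → WeakCouplingBCS/H3 consumers»; LADDER-Hubbard v1.17 WORDING
OF RECORD (ii): «R2d concludes a `T > 0` normal-phase `B1g` instability + channel selection at `0 < U < U₀`, whereas H0 (B)
quantifies over EVERY GROUND STATE (`T = 0`) and asserts pair LRO — the gap is carried by H3 `WeakCouplingBCS` + engines»).
Support file for crux 4 `WcbcsBcsConstruction` (stmt-HubbardSuperconductivity-2010).  Companion of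
`…Theorems.WeakCouplingBCSH1TwoPointLimitKLScaleDPlumbing` (leaf plumbing, `δ → μ` transport, the loaded pair) and of the sibling
audit `…Theorems.WeakCouplingBCSKLBridgeAudit` (seat h1-p2: the pair's STATEMENT is pairing-blind; the `T > 0` box is inside the
Hohenberg–Mermin–Wagner dead zone; `closes` uses crux 2 + crux 4 only).

THE H3 SIDE, of record (`Cruxes/WcbcsBcsConstruction/LINE-STATUS.md`, registered skeleton rev c5-2 of stmt-2010): crux 4 ≡
(Penc) a one-point Kohn–Luttinger certificate at `μ = -21/25` + (M_loc) `stub_dWaveOrderFloorOnLeadingWindows` — THE research stub,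
«the weak-coupling constructive KL/BCS programme, symmetric AND broken regime»: for every level window `[μ₁, μ₂] ⊂ [-2, -3/10]` on
which `B1g` leads every other `D₄` channel of the second-order vertex by `γU²` for `U < U₁`, an order floor
`e^{-C/U²} ≤ dWaveOrderParameter U μ` on `[μ₁ + U/2, μ₂]` for all `U ∈ (0, U₀)` — + (D_loc) no density jump (typed form only);
and crux 2 `WcbcsSsbToTorusLRO` + thin order ⇒ summit (`hubbardSuperconductivity_of_wcbcsSsbToTorusLRO_of_thinOrder`, landed).

WHAT RUNG R2d CHANGES THERE (this file, sorry-free, standard axioms, no definition, items BY NAME or hypotheses VERBATIM):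

§1 `thinOrder_of_shiftedWindowFloor` — an order floor on the shifted windows `[μ₁ + U/2, μ₂]`, `-21/25 ≤ μ₁ < μ₂ ≤ -7/20` (the
   conclusion shape of (M_loc)) gives THIN ORDER (`d`-wave symmetry breaking on a `μ`-sub-interval of `[-21/25, -7/20]` at
   arbitrarily small `U`); generalises the landed `wcbcs_thinOrder_of_windowFloor` (unshifted fixed window).
§2 THE CERTIFICATE HALF REPLACES (Penc): `thinOrder_of_r2dCert_of_klMechanism`,
   `thinCrux_of_r2dCert_of_klMechanism`, `hubbardSuperconductivity_of_r2dCert_of_klMechanism_of_ssbToTorusLRO` — the three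
   referee-replayed window records `klCertB1gWin{A,B,C}.EnclosuresB1g` of R2d's certificate half (cert form (A) of record, VERIFIED on
   stmt-0158; `klb1g_window_d010_d020`: `B1g` leads by `γU²` on `μ ∈ [-0.42749, -0.1775]`, all `U < 1`) feed (M_loc) on the level
   window `[-0.42749, -7/20]` DIRECTLY; with (M_loc) VERBATIM as hypothesis they give thin order, the thin crux, and — with crux 2 BY
   NAME — the summit `HubbardSuperconductivity`.  So on H3 the Kohn–Luttinger INPUT of crux 4's line is no longer an open
   certificate: the open content is (M_loc) (+ crux 2; + (D_loc) for the typed `U`-uniform `δ`).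
§3 THE THEOREM HALF RELATIVISES (M_loc): the bridge hypothesis «(M_loc | normal-phase control)» — (M_loc)'s signature with ONE
   antecedent added, the leaf's conclusion transported to the same `μ`-window (thermal two-point limits for all `0 < U ≤ U₀`,
   `0 < β ≤ e^{c/U²}` at every `μ ∈ [μ₁, μ₂]`) — is implied by (M_loc) (`klMechanismRel_of_klMechanism`) and, TOGETHER WITH the leaf
   `H1TwoPointLimitKLScaleD` (by name, through `R2dH1.control_on_muWindow_of_fillings` and the two certified free fillings
   `klwL_filling_ge : 13/20 ≤ n(-21/50)`, `klwU_filling_le : n(-7/20) ≤ 9/10` of the companion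
   `…Theorems.WeakCouplingBCSH1TwoPointLimitKLScaleDFillings`), the certificate half and crux 2, gives the summit
   (`hubbardSuperconductivity_of_klPair_of_klMechanismRel_of_ssbToTorusLRO`) and the thin crux.  Every binder is load-bearing.
   HONEST READING: the relativised stub is the typed shape of «stage 2 (the `h`-seeded symmetry-broken expansion below the
   Kohn–Luttinger scale) GIVEN stage 1 (the sign-resolved normal-phase expansion down to it)»; its antecedent is the leaf's
   existence SHADOW, which is pairing-blind (audit §4), so the mathematical interface stage 2 will actually consume is the
   KLProgramme engine's output (the `klPreds` bundle at the last scale), not this antecedent — the door fixes the LOGICAL shape and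
   the names, not the analysis.  No `T > 0` statement can replace the bridge (audit §2).

§4 (appended 2026-08-26) THE RATE-KEEPING CRUX WITHOUT (D_loc): `rateKeepingCrux_of_shiftedWindowFloor`,
   `rateKeepingCrux_of_r2dCert_of_klMechanism`, `rateKeepingCrux_of_klPair_of_klMechanismRel` — form (b) of
   `Cruxes/WcbcsBcsConstruction/LINE-STATUS.md` (the crux-4 lead's recommended restatement: `∃ U₀ C > 0, ∀ U ∈ (0, U₀), ∃ δ ∈ (0,1/2),
   ∃ μ` density-matched with `e^{-C/U²} ≤ dWaveOrderParameter U μ`, i.e. the typed crux with a `U`-DEPENDENT doping; it implies the thin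
   crux and is implied by the typed crux) follows from an order floor on the shifted windows ALONE, density matching being free at EVERY
   small `U` by the landed a.e.-matching (T3) `stub_aeDensityMatching` ∘ (T2) `stub_densityInsideUnitWindow` ∘ (T1)
   `stub_freeLevelCountsOuter`; hence from {R2d certificate, (M_loc)} and from {KL pair, relativised (M_loc)} — NO no-density-jump stub.
   (The typed `U`-uniform `δ` does need (D_loc): companion `…Theorems.WeakCouplingBCSH1TwoPointLimitKLScaleDTypedCrux`.)

Sources: T. Koma, H. Tasaki, J. Stat. Phys. 76 (1994) 745, §1 (order parameter, order of limits); S. Raghu, S. A. Kivelson,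
D. J. Scalapino, Phys. Rev. B 81 (2010) 224505, §III Fig. 2 (`B1g` window); G. Benfatto, A. Giuliani, V. Mastropietro, Ann. Henri
Poincaré 7 (2006) 809, Thm 1.1 (normal phase above `e^{-a/U}`); J. Feldman, J. Magnen, V. Rivasseau, E. Trubowitz, Europhys.
Lett. 24 (1993) 437 (symmetry-broken BCS expansion, the intended stage 2).
-/

noncomputable section

-- the tree's namespace `Summit.<Summit>.<Problem>.Theorems` repeats the summit name by design (D-0017)
set_option linter.dupNamespace false

namespace Summit.HubbardSuperconductivity.HubbardSuperconductivity.Theorems.R2dH1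

open Filter Set
open Literature.MathematicalPhysics.QuantumLattice Literature.Probability.LatticeModels
open Summit.HubbardSuperconductivity.HubbardSuperconductivity.Theses.WeakCouplingBCS
  (H1TwoPointLimitKLScaleD WcbcsKohnLuttingerB1g WcbcsSsbToTorusLRO)
open scoped Topology

/-! ### §1 Shifted window floor ⇒ thin order -/

/-- **An order floor on the shifted windows gives thin order.** If `-21/25 ≤ μ₁ < μ₂ ≤ -7/20` and for all `U ∈ (0, U₀)` and
`μ ∈ [μ₁ + U/2, μ₂]` one has `e^{-C/U²} ≤ dWaveOrderParameter U μ` (the conclusion shape of crux 4's registered stub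
`stub_dWaveOrderFloorOnLeadingWindows`), then for every `U₁' > 0` some `U ∈ (0, U₁')` has `HasDWaveOrder U μ` on an open
sub-interval of `[-21/25, -7/20]` (namely `(μ₁ + U/2, μ₂)` with `U := min (min U₀ U₁') (μ₂ - μ₁) / 2`). [cite: KomaTasaki1994, §1] -/
theorem thinOrder_of_shiftedWindowFloor {μ₁ μ₂ : ℝ} (hμ₁ : -(21:ℝ) / 25 ≤ μ₁) (h12 : μ₁ < μ₂) (hμ₂ : μ₂ ≤ -(7:ℝ) / 20)
    (hfl : ∃ U₀ C : ℝ, 0 < U₀ ∧ 0 < C ∧ ∀ U ∈ Set.Ioo (0:ℝ) U₀, ∀ μ ∈ Set.Icc (μ₁ + U / 2) μ₂,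
      Real.exp (-C / U ^ 2) ≤ dWaveOrderParameter U μ) :
    ∀ U₁ : ℝ, 0 < U₁ → ∃ U ∈ Set.Ioo (0:ℝ) U₁, ∃ a b : ℝ, -(21:ℝ) / 25 ≤ a ∧ a < b ∧ b ≤ -(7:ℝ) / 20 ∧
      ∀ μ ∈ Set.Ioo a b, HasDWaveOrder U μ := by
  intro U₁ hU₁
  obtain ⟨U₀, C, hU₀, -, hfl⟩ := hfl
  set U : ℝ := min (min U₀ U₁) (μ₂ - μ₁) / 2 with hU
  have hm : 0 < min (min U₀ U₁) (μ₂ - μ₁) := lt_min (lt_min hU₀ hU₁) (by linarith)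
  have hUpos : 0 < U := by rw [hU]; linarith
  have hUlt : U < min (min U₀ U₁) (μ₂ - μ₁) := by rw [hU]; linarith
  have hU₀' : U < U₀ := lt_of_lt_of_le hUlt ((min_le_left _ _).trans (min_le_left _ _))
  have hU₁' : U < U₁ := lt_of_lt_of_le hUlt ((min_le_left _ _).trans (min_le_right _ _))
  have hgap : U < μ₂ - μ₁ := lt_of_lt_of_le hUlt (min_le_right _ _)
  refine ⟨U, ⟨hUpos, hU₁'⟩, μ₁ + U / 2, μ₂, by linarith, by linarith, hμ₂, fun μ hμ => ?_⟩
  exact (hasDWaveOrder_iff _ _).2 (lt_of_lt_of_le (Real.exp_pos _)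
    (hfl U ⟨hUpos, hU₀'⟩ μ ⟨hμ.1.le, hμ.2.le⟩))

/-! ### §2 The certificate half of R2d replaces the Kohn–Luttinger certificate stub of crux 4's line -/

/-- **`B1g` leading on the level window `[-0.42749, -7/20]`** from the three window records of R2d's certificate half
(`klb1g_window_d010_d020` restricted; `U₁ = 1`, `γ` = the least record margin, positive). [cite: RaghuKivelsonScalapino2010, §III Fig. 2] -/
theorem r2dCert_leading_levelWindow (hA : klCertB1gWinA.EnclosuresB1g) (hB : klCertB1gWinB.EnclosuresB1g)
    (hC : klCertB1gWinC.EnclosuresB1g) :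
    ∃ γ : ℝ, 0 < γ ∧ ∀ U ∈ Set.Ioo (0:ℝ) 1, ∀ μ ∈ Set.Icc (-0.42749 : ℝ) (-(7:ℝ) / 20), ∀ χ : D4Irrep, χ ≠ D4Irrep.B1g →
      channelInf (squareDispersion 1 0) μ U D4Irrep.B1g + γ * U ^ 2 ≤ channelInf (squareDispersion 1 0) μ U χ := by
  have hγ : (0 : ℝ) < min (min ((klCertB1gWinA.gamma : ℚ) : ℝ) ((klCertB1gWinB.gamma : ℚ) : ℝ))
      ((klCertB1gWinC.gamma : ℚ) : ℝ) := by
    have h := klb1g_window_d010_d020_gamma_pos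
    exact_mod_cast h
  refine ⟨_, hγ, fun U hU μ hμ χ hχ => ?_⟩
  exact klb1g_window_d010_d020 hA hB hC μ ⟨hμ.1, hμ.2.trans (by norm_num)⟩ U hU χ hχ

/-- **Thin order from R2d's certificate half and crux 4's research stub (M_loc) VERBATIM.** The window records feed
`stub_dWaveOrderFloorOnLeadingWindows` (its signature is the hypothesis `hM`, byte-identical to the registered stub of stmt-2010 /
stmt-1740) on the level window `[-0.42749, -7/20] ⊂ [-2, -3/10]`; the resulting floor on `[-0.42749 + U/2, -7/20]` gives thin order
by §1.  No one-point certificate (Penc) is used. [cite: KomaTasaki1994, §1] -/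
theorem thinOrder_of_r2dCert_of_klMechanism (hA : klCertB1gWinA.EnclosuresB1g) (hB : klCertB1gWinB.EnclosuresB1g)
    (hC : klCertB1gWinC.EnclosuresB1g)
    (hM : ∀ μ₁ μ₂ γ U₁ : ℝ, -2 ≤ μ₁ → μ₁ < μ₂ → μ₂ ≤ -(3:ℝ) / 10 → 0 < γ → 0 < U₁ →
      (∀ U ∈ Set.Ioo (0:ℝ) U₁, ∀ μ ∈ Set.Icc μ₁ μ₂, ∀ χ : D4Irrep, χ ≠ D4Irrep.B1g →
        channelInf (squareDispersion 1 0) μ U D4Irrep.B1g + γ * U ^ 2 ≤ channelInf (squareDispersion 1 0) μ U χ) →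
      ∃ U₀ C : ℝ, 0 < U₀ ∧ 0 < C ∧ ∀ U ∈ Set.Ioo (0:ℝ) U₀, ∀ μ ∈ Set.Icc (μ₁ + U / 2) μ₂,
        Real.exp (-C / U ^ 2) ≤ dWaveOrderParameter U μ) :
    ∀ U₁ : ℝ, 0 < U₁ → ∃ U ∈ Set.Ioo (0:ℝ) U₁, ∃ a b : ℝ, -(21:ℝ) / 25 ≤ a ∧ a < b ∧ b ≤ -(7:ℝ) / 20 ∧
      ∀ μ ∈ Set.Ioo a b, HasDWaveOrder U μ := by
  obtain ⟨γ, hγ, hlead⟩ := r2dCert_leading_levelWindow hA hB hC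
  exact thinOrder_of_shiftedWindowFloor (μ₁ := -0.42749) (μ₂ := -(7:ℝ) / 20) (by norm_num) (by norm_num) le_rfl
    (hM (-0.42749) (-(7:ℝ) / 20) γ 1 (by norm_num) (by norm_num) (by norm_num) hγ one_pos hlead)

/-- **The thin crux from R2d's certificate half and (M_loc)** (density matching for free: `wcbcs_thinCrux_of_thinOrder`, landed):
for every `U₁ > 0` some `U ∈ (0, U₁)`, `δ ∈ (0, 1/2)` and `μ` with grand-canonical ground-state density `→ 1 - δ` and
`HasDWaveOrder U μ`. [cite: KomaTasaki1994, §1] -/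
theorem thinCrux_of_r2dCert_of_klMechanism (hA : klCertB1gWinA.EnclosuresB1g) (hB : klCertB1gWinB.EnclosuresB1g)
    (hC : klCertB1gWinC.EnclosuresB1g)
    (hM : ∀ μ₁ μ₂ γ U₁ : ℝ, -2 ≤ μ₁ → μ₁ < μ₂ → μ₂ ≤ -(3:ℝ) / 10 → 0 < γ → 0 < U₁ →
      (∀ U ∈ Set.Ioo (0:ℝ) U₁, ∀ μ ∈ Set.Icc μ₁ μ₂, ∀ χ : D4Irrep, χ ≠ D4Irrep.B1g →
        channelInf (squareDispersion 1 0) μ U D4Irrep.B1g + γ * U ^ 2 ≤ channelInf (squareDispersion 1 0) μ U χ) →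
      ∃ U₀ C : ℝ, 0 < U₀ ∧ 0 < C ∧ ∀ U ∈ Set.Ioo (0:ℝ) U₀, ∀ μ ∈ Set.Icc (μ₁ + U / 2) μ₂,
        Real.exp (-C / U ^ 2) ≤ dWaveOrderParameter U μ) :
    ∀ U₁ : ℝ, 0 < U₁ → ∃ U ∈ Set.Ioo (0:ℝ) U₁, ∃ δ ∈ Set.Ioo (0:ℝ) (1 / 2), ∃ μ : ℝ,
      Tendsto (fun L : ℕ => ((hubbardTorusWith 2 (L + 1) 1 U μ).groundStateFunctional
        totalNumber).re / ((L + 1 : ℕ) : ℝ) ^ 2) atTop (𝓝 (1 - δ)) ∧ HasDWaveOrder U μ :=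
  wcbcs_thinCrux_of_thinOrder (thinOrder_of_r2dCert_of_klMechanism hA hB hC hM)

/-- **THE SUMMIT FROM R2d's CERTIFICATE HALF, (M_loc) AND CRUX 2.** The three referee-replayed window enclosure records of the
rung's certificate half, crux 4's registered research stub `stub_dWaveOrderFloorOnLeadingWindows` VERBATIM (`hM`) and crux 2
`WcbcsSsbToTorusLRO` BY NAME imply `HubbardSuperconductivity` (thin order by §2, then the landed thin sufficiency).  On ladder H3
this is crux 4's line with its Kohn–Luttinger input DISCHARGED by rung R2d's certificate: the open content is (M_loc) + crux 2.
[cite: KomaTasaki1994, §1] -/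
theorem hubbardSuperconductivity_of_r2dCert_of_klMechanism_of_ssbToTorusLRO (hA : klCertB1gWinA.EnclosuresB1g)
    (hB : klCertB1gWinB.EnclosuresB1g) (hC : klCertB1gWinC.EnclosuresB1g)
    (hM : ∀ μ₁ μ₂ γ U₁ : ℝ, -2 ≤ μ₁ → μ₁ < μ₂ → μ₂ ≤ -(3:ℝ) / 10 → 0 < γ → 0 < U₁ →
      (∀ U ∈ Set.Ioo (0:ℝ) U₁, ∀ μ ∈ Set.Icc μ₁ μ₂, ∀ χ : D4Irrep, χ ≠ D4Irrep.B1g →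
        channelInf (squareDispersion 1 0) μ U D4Irrep.B1g + γ * U ^ 2 ≤ channelInf (squareDispersion 1 0) μ U χ) →
      ∃ U₀ C : ℝ, 0 < U₀ ∧ 0 < C ∧ ∀ U ∈ Set.Ioo (0:ℝ) U₀, ∀ μ ∈ Set.Icc (μ₁ + U / 2) μ₂,
        Real.exp (-C / U ^ 2) ≤ dWaveOrderParameter U μ)
    (h2 : WcbcsSsbToTorusLRO) : _root_.HubbardSuperconductivity :=
  hubbardSuperconductivity_of_wcbcsSsbToTorusLRO_of_thinOrder h2 (thinOrder_of_r2dCert_of_klMechanism hA hB hC hM)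

/-! ### §3 The theorem half relativises (M_loc): the bridge «(M_loc | normal-phase control)» -/

/-- **(M_loc) implies its relativisation to normal-phase control** — the bridge hypothesis of §3 is WEAKER than crux 4's registered
research stub (it carries one more antecedent: the leaf's conclusion on the same `μ`-window). [folklore] -/
theorem klMechanismRel_of_klMechanism
    (hM : ∀ μ₁ μ₂ γ U₁ : ℝ, -2 ≤ μ₁ → μ₁ < μ₂ → μ₂ ≤ -(3:ℝ) / 10 → 0 < γ → 0 < U₁ →
      (∀ U ∈ Set.Ioo (0:ℝ) U₁, ∀ μ ∈ Set.Icc μ₁ μ₂, ∀ χ : D4Irrep, χ ≠ D4Irrep.B1g →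
        channelInf (squareDispersion 1 0) μ U D4Irrep.B1g + γ * U ^ 2 ≤ channelInf (squareDispersion 1 0) μ U χ) →
      ∃ U₀ C : ℝ, 0 < U₀ ∧ 0 < C ∧ ∀ U ∈ Set.Ioo (0:ℝ) U₀, ∀ μ ∈ Set.Icc (μ₁ + U / 2) μ₂,
        Real.exp (-C / U ^ 2) ≤ dWaveOrderParameter U μ) :
    ∀ μ₁ μ₂ γ U₁ U₀ c : ℝ, -2 ≤ μ₁ → μ₁ < μ₂ → μ₂ ≤ -(3:ℝ) / 10 → 0 < γ → 0 < U₁ → 0 < U₀ → 0 < c →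
      (∀ μ ∈ Set.Icc μ₁ μ₂, ∀ U β : ℝ, 0 < U → U ≤ U₀ → 0 < β → β ≤ Real.exp (c / U ^ 2) →
        ∀ (x y : Site 2) (σ σ' : Fin 2), ∃ S : ℂ,
          Tendsto (fun L : ℕ => hubbardThermalTwoPoint β U μ L x y σ σ') atTop (𝓝 S)) →
      (∀ U ∈ Set.Ioo (0:ℝ) U₁, ∀ μ ∈ Set.Icc μ₁ μ₂, ∀ χ : D4Irrep, χ ≠ D4Irrep.B1g →
        channelInf (squareDispersion 1 0) μ U D4Irrep.B1g + γ * U ^ 2 ≤ channelInf (squareDispersion 1 0) μ U χ) →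
      ∃ U₀' C : ℝ, 0 < U₀' ∧ 0 < C ∧ ∀ U ∈ Set.Ioo (0:ℝ) U₀', ∀ μ ∈ Set.Icc (μ₁ + U / 2) μ₂,
        Real.exp (-C / U ^ 2) ≤ dWaveOrderParameter U μ :=
  fun μ₁ μ₂ γ U₁ _U₀ _c hμ₁ h12 hμ₂ hγ hU₁ _ _ _ hlead => hM μ₁ μ₂ γ U₁ hμ₁ h12 hμ₂ hγ hU₁ hlead

/-- **THE DOOR: the KL pair + «(M_loc | normal-phase control)» + crux 2 ⇒ the summit.** Hypotheses: the leaf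
`H1TwoPointLimitKLScaleD` BY NAME (theorem half of R2d), the three window enclosure records (certificate half, form (A)), the
RELATIVISED research stub `hBr` («stage 2 given stage 1», §3 of the module docstring) and crux 2 `WcbcsSsbToTorusLRO` BY NAME.
Proof: transport the leaf to the level window `[-21/50, -7/20]` (`R2dH1.control_on_muWindow_of_fillings` with the certified
fillings `klwL_filling_ge`, `klwU_filling_le`), feed it and the certificate's `γU²`-leading to `hBr`, get the floor on
`[-21/50 + U/2, -7/20]`, thin order (§1), summit (thin sufficiency).  Every binder is load-bearing; the leaf discharges exactly the
added antecedent. [cite: KomaTasaki1994, §1] -/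
theorem hubbardSuperconductivity_of_klPair_of_klMechanismRel_of_ssbToTorusLRO (hleaf : H1TwoPointLimitKLScaleD)
    (hA : klCertB1gWinA.EnclosuresB1g) (hB : klCertB1gWinB.EnclosuresB1g) (hC : klCertB1gWinC.EnclosuresB1g)
    (hBr : ∀ μ₁ μ₂ γ U₁ U₀ c : ℝ, -2 ≤ μ₁ → μ₁ < μ₂ → μ₂ ≤ -(3:ℝ) / 10 → 0 < γ → 0 < U₁ → 0 < U₀ → 0 < c →
      (∀ μ ∈ Set.Icc μ₁ μ₂, ∀ U β : ℝ, 0 < U → U ≤ U₀ → 0 < β → β ≤ Real.exp (c / U ^ 2) →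
        ∀ (x y : Site 2) (σ σ' : Fin 2), ∃ S : ℂ,
          Tendsto (fun L : ℕ => hubbardThermalTwoPoint β U μ L x y σ σ') atTop (𝓝 S)) →
      (∀ U ∈ Set.Ioo (0:ℝ) U₁, ∀ μ ∈ Set.Icc μ₁ μ₂, ∀ χ : D4Irrep, χ ≠ D4Irrep.B1g →
        channelInf (squareDispersion 1 0) μ U D4Irrep.B1g + γ * U ^ 2 ≤ channelInf (squareDispersion 1 0) μ U χ) →
      ∃ U₀' C : ℝ, 0 < U₀' ∧ 0 < C ∧ ∀ U ∈ Set.Ioo (0:ℝ) U₀', ∀ μ ∈ Set.Icc (μ₁ + U / 2) μ₂,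
        Real.exp (-C / U ^ 2) ≤ dWaveOrderParameter U μ)
    (h2 : WcbcsSsbToTorusLRO) : _root_.HubbardSuperconductivity := by
  -- stage 1 (the leaf), transported to the level window `[-21/50, -7/20]`
  obtain ⟨U₀, c, hU₀, hc, hctl⟩ :=
    control_on_muWindow_of_fillings hleaf (μ₁ := -(21:ℝ) / 50) (μ₂ := -(7:ℝ) / 20) (by norm_num) (by norm_num)
      klwL_filling_ge klwU_filling_le
  -- the certificate half on the same window
  obtain ⟨γ, hγ, hlead⟩ := r2dCert_leading_levelWindow hA hB hC
  have hlead' : ∀ U ∈ Set.Ioo (0:ℝ) 1, ∀ μ ∈ Set.Icc (-(21:ℝ) / 50) (-(7:ℝ) / 20), ∀ χ : D4Irrep,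
      χ ≠ D4Irrep.B1g → channelInf (squareDispersion 1 0) μ U D4Irrep.B1g + γ * U ^ 2 ≤
        channelInf (squareDispersion 1 0) μ U χ :=
    fun U hU μ hμ χ hχ => hlead U hU μ ⟨le_trans (by norm_num) hμ.1, hμ.2⟩ χ hχ
  -- stage 2 given stage 1: the floor on the shifted windows, then thin order and the summit
  have hfl := hBr (-(21:ℝ) / 50) (-(7:ℝ) / 20) γ 1 U₀ c (by norm_num) (by norm_num) (by norm_num) hγ one_pos hU₀ hc
    hctl hlead'
  exact hubbardSuperconductivity_of_wcbcsSsbToTorusLRO_of_thinOrder h2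
    (thinOrder_of_shiftedWindowFloor (by norm_num) (by norm_num) le_rfl hfl)

/-- **The thin crux from the KL pair and the relativised stub** (same proof without crux 2: density matching is free,
`wcbcs_thinCrux_of_thinOrder`). [cite: KomaTasaki1994, §1] -/
theorem thinCrux_of_klPair_of_klMechanismRel (hleaf : H1TwoPointLimitKLScaleD)
    (hA : klCertB1gWinA.EnclosuresB1g) (hB : klCertB1gWinB.EnclosuresB1g) (hC : klCertB1gWinC.EnclosuresB1g)
    (hBr : ∀ μ₁ μ₂ γ U₁ U₀ c : ℝ, -2 ≤ μ₁ → μ₁ < μ₂ → μ₂ ≤ -(3:ℝ) / 10 → 0 < γ → 0 < U₁ → 0 < U₀ → 0 < c →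
      (∀ μ ∈ Set.Icc μ₁ μ₂, ∀ U β : ℝ, 0 < U → U ≤ U₀ → 0 < β → β ≤ Real.exp (c / U ^ 2) →
        ∀ (x y : Site 2) (σ σ' : Fin 2), ∃ S : ℂ,
          Tendsto (fun L : ℕ => hubbardThermalTwoPoint β U μ L x y σ σ') atTop (𝓝 S)) →
      (∀ U ∈ Set.Ioo (0:ℝ) U₁, ∀ μ ∈ Set.Icc μ₁ μ₂, ∀ χ : D4Irrep, χ ≠ D4Irrep.B1g →
        channelInf (squareDispersion 1 0) μ U D4Irrep.B1g + γ * U ^ 2 ≤ channelInf (squareDispersion 1 0) μ U χ) →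
      ∃ U₀' C : ℝ, 0 < U₀' ∧ 0 < C ∧ ∀ U ∈ Set.Ioo (0:ℝ) U₀', ∀ μ ∈ Set.Icc (μ₁ + U / 2) μ₂,
        Real.exp (-C / U ^ 2) ≤ dWaveOrderParameter U μ) :
    ∀ U₁ : ℝ, 0 < U₁ → ∃ U ∈ Set.Ioo (0:ℝ) U₁, ∃ δ ∈ Set.Ioo (0:ℝ) (1 / 2), ∃ μ : ℝ,
      Tendsto (fun L : ℕ => ((hubbardTorusWith 2 (L + 1) 1 U μ).groundStateFunctional
        totalNumber).re / ((L + 1 : ℕ) : ℝ) ^ 2) atTop (𝓝 (1 - δ)) ∧ HasDWaveOrder U μ := by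
  obtain ⟨U₀, c, hU₀, hc, hctl⟩ :=
    control_on_muWindow_of_fillings hleaf (μ₁ := -(21:ℝ) / 50) (μ₂ := -(7:ℝ) / 20) (by norm_num) (by norm_num)
      klwL_filling_ge klwU_filling_le
  obtain ⟨γ, hγ, hlead⟩ := r2dCert_leading_levelWindow hA hB hC
  have hlead' : ∀ U ∈ Set.Ioo (0:ℝ) 1, ∀ μ ∈ Set.Icc (-(21:ℝ) / 50) (-(7:ℝ) / 20), ∀ χ : D4Irrep,
      χ ≠ D4Irrep.B1g → channelInf (squareDispersion 1 0) μ U D4Irrep.B1g + γ * U ^ 2 ≤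
        channelInf (squareDispersion 1 0) μ U χ :=
    fun U hU μ hμ χ hχ => hlead U hU μ ⟨le_trans (by norm_num) hμ.1, hμ.2⟩ χ hχ
  have hfl := hBr (-(21:ℝ) / 50) (-(7:ℝ) / 20) γ 1 U₀ c (by norm_num) (by norm_num) (by norm_num) hγ one_pos hU₀ hc
    hctl hlead'
  exact wcbcs_thinCrux_of_thinOrder (thinOrder_of_shiftedWindowFloor (by norm_num) (by norm_num) le_rfl hfl)

/-! ### §4 The rate-keeping crux (LINE-STATUS form (b)) from a shifted window floor — no (D_loc) (appended 2026-08-26) -/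

/-- **A shifted window floor gives the RATE-KEEPING crux** (form (b) of `Cruxes/WcbcsBcsConstruction/LINE-STATUS.md`: the typed crux
with a `U`-dependent doping).  If `-21/25 ≤ μ₁ < μ₂ ≤ -7/20` and `e^{-C/U²} ≤ dWaveOrderParameter U μ` for all `U ∈ (0, U₀)`,
`μ ∈ [μ₁ + U/2, μ₂]`, then there are `U₀', C > 0` such that for EVERY `U ∈ (0, U₀')` some `δ ∈ (0, 1/2)` and some `μ` have
grand-canonical ground-state density `→ 1 - δ` and `e^{-C/U²} ≤ dWaveOrderParameter U μ`.  Density matching at every small `U` is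
the landed a.e.-matching chain (T3) `stub_aeDensityMatching` ∘ (T2) `stub_densityInsideUnitWindow` ∘ (T1) `stub_freeLevelCountsOuter`
applied to the open interval `(μ₁ + U/2, μ₂)`; no no-density-jump hypothesis. [cite: KomaTasaki1994, §1] -/
theorem rateKeepingCrux_of_shiftedWindowFloor {μ₁ μ₂ : ℝ} (hμ₁ : -(21:ℝ) / 25 ≤ μ₁) (h12 : μ₁ < μ₂)
    (hμ₂ : μ₂ ≤ -(7:ℝ) / 20)
    (hfl : ∃ U₀ C : ℝ, 0 < U₀ ∧ 0 < C ∧ ∀ U ∈ Set.Ioo (0:ℝ) U₀, ∀ μ ∈ Set.Icc (μ₁ + U / 2) μ₂,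
      Real.exp (-C / U ^ 2) ≤ dWaveOrderParameter U μ) :
    ∃ U₀ : ℝ, 0 < U₀ ∧ ∃ C : ℝ, 0 < C ∧ ∀ U ∈ Set.Ioo (0:ℝ) U₀, ∃ δ ∈ Set.Ioo (0:ℝ) (1 / 2), ∃ μ : ℝ,
      Tendsto (fun L : ℕ => ((hubbardTorusWith 2 (L + 1) 1 U μ).groundStateFunctional
        totalNumber).re / ((L + 1 : ℕ) : ℝ) ^ 2) atTop (𝓝 (1 - δ)) ∧
      Real.exp (-C / U ^ 2) ≤ dWaveOrderParameter U μ := by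
  obtain ⟨U₃, hU₃, hT3⟩ := stub_aeDensityMatching (stub_densityInsideUnitWindow stub_freeLevelCountsOuter)
  obtain ⟨U₀, C, hU₀, hC, hfl⟩ := hfl
  refine ⟨min U₀ (min U₃ (μ₂ - μ₁)), lt_min hU₀ (lt_min hU₃ (by linarith)), C, hC, fun U hU => ?_⟩
  have hUpos : 0 < U := hU.1
  have hUU₀ : U < U₀ := lt_of_lt_of_le hU.2 (min_le_left _ _)
  have hUU₃ : U < U₃ := lt_of_lt_of_le hU.2 ((min_le_right _ _).trans (min_le_left _ _))
  have hUw : U < μ₂ - μ₁ := lt_of_lt_of_le hU.2 ((min_le_right _ _).trans (min_le_right _ _))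
  obtain ⟨μ, hμ, δ, hδ, hdens⟩ := hT3 U ⟨hUpos.le, hUU₃.le⟩ (μ₁ + U / 2) μ₂ (by linarith) (by linarith) hμ₂
  exact ⟨δ, hδ, μ, hdens, hfl U ⟨hUpos, hUU₀⟩ μ ⟨hμ.1.le, hμ.2.le⟩⟩

/-- **The rate-keeping crux from R2d's certificate half and (M_loc) VERBATIM** — no (D_loc): {window records A,B,C, (M_loc)} ⇒
`∃ U₀ C > 0, ∀ U ∈ (0,U₀), ∃ δ ∈ (0,1/2), ∃ μ` density-matched with `e^{-C/U²} ≤ dWaveOrderParameter U μ`.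
[cite: KomaTasaki1994, §1] -/
theorem rateKeepingCrux_of_r2dCert_of_klMechanism (hA : klCertB1gWinA.EnclosuresB1g) (hB : klCertB1gWinB.EnclosuresB1g)
    (hC : klCertB1gWinC.EnclosuresB1g)
    (hM : ∀ μ₁ μ₂ γ U₁ : ℝ, -2 ≤ μ₁ → μ₁ < μ₂ → μ₂ ≤ -(3:ℝ) / 10 → 0 < γ → 0 < U₁ →
      (∀ U ∈ Set.Ioo (0:ℝ) U₁, ∀ μ ∈ Set.Icc μ₁ μ₂, ∀ χ : D4Irrep, χ ≠ D4Irrep.B1g →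
        channelInf (squareDispersion 1 0) μ U D4Irrep.B1g + γ * U ^ 2 ≤ channelInf (squareDispersion 1 0) μ U χ) →
      ∃ U₀ C : ℝ, 0 < U₀ ∧ 0 < C ∧ ∀ U ∈ Set.Ioo (0:ℝ) U₀, ∀ μ ∈ Set.Icc (μ₁ + U / 2) μ₂,
        Real.exp (-C / U ^ 2) ≤ dWaveOrderParameter U μ) :
    ∃ U₀ : ℝ, 0 < U₀ ∧ ∃ C : ℝ, 0 < C ∧ ∀ U ∈ Set.Ioo (0:ℝ) U₀, ∃ δ ∈ Set.Ioo (0:ℝ) (1 / 2), ∃ μ : ℝ,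
      Tendsto (fun L : ℕ => ((hubbardTorusWith 2 (L + 1) 1 U μ).groundStateFunctional
        totalNumber).re / ((L + 1 : ℕ) : ℝ) ^ 2) atTop (𝓝 (1 - δ)) ∧
      Real.exp (-C / U ^ 2) ≤ dWaveOrderParameter U μ := by
  obtain ⟨γ, hγ, hlead⟩ := r2dCert_leading_levelWindow hA hB hC
  exact rateKeepingCrux_of_shiftedWindowFloor (μ₁ := -0.42749) (μ₂ := -(7:ℝ) / 20) (by norm_num) (by norm_num) le_rfl
    (hM (-0.42749) (-(7:ℝ) / 20) γ 1 (by norm_num) (by norm_num) (by norm_num) hγ one_pos hlead)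

/-- **The rate-keeping crux from the KL pair and the relativised stub** (leaf `H1TwoPointLimitKLScaleD` BY NAME, transported to
`[-21/50, -7/20]` with the certified fillings; certificate half; «(M_loc | normal-phase control)»; no (D_loc)). [cite: KomaTasaki1994, §1] -/
theorem rateKeepingCrux_of_klPair_of_klMechanismRel (hleaf : H1TwoPointLimitKLScaleD)
    (hA : klCertB1gWinA.EnclosuresB1g) (hB : klCertB1gWinB.EnclosuresB1g) (hC : klCertB1gWinC.EnclosuresB1g)
    (hBr : ∀ μ₁ μ₂ γ U₁ U₀ c : ℝ, -2 ≤ μ₁ → μ₁ < μ₂ → μ₂ ≤ -(3:ℝ) / 10 → 0 < γ → 0 < U₁ → 0 < U₀ → 0 < c →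
      (∀ μ ∈ Set.Icc μ₁ μ₂, ∀ U β : ℝ, 0 < U → U ≤ U₀ → 0 < β → β ≤ Real.exp (c / U ^ 2) →
        ∀ (x y : Site 2) (σ σ' : Fin 2), ∃ S : ℂ,
          Tendsto (fun L : ℕ => hubbardThermalTwoPoint β U μ L x y σ σ') atTop (𝓝 S)) →
      (∀ U ∈ Set.Ioo (0:ℝ) U₁, ∀ μ ∈ Set.Icc μ₁ μ₂, ∀ χ : D4Irrep, χ ≠ D4Irrep.B1g →
        channelInf (squareDispersion 1 0) μ U D4Irrep.B1g + γ * U ^ 2 ≤ channelInf (squareDispersion 1 0) μ U χ) →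
      ∃ U₀' C : ℝ, 0 < U₀' ∧ 0 < C ∧ ∀ U ∈ Set.Ioo (0:ℝ) U₀', ∀ μ ∈ Set.Icc (μ₁ + U / 2) μ₂,
        Real.exp (-C / U ^ 2) ≤ dWaveOrderParameter U μ) :
    ∃ U₀ : ℝ, 0 < U₀ ∧ ∃ C : ℝ, 0 < C ∧ ∀ U ∈ Set.Ioo (0:ℝ) U₀, ∃ δ ∈ Set.Ioo (0:ℝ) (1 / 2), ∃ μ : ℝ,
      Tendsto (fun L : ℕ => ((hubbardTorusWith 2 (L + 1) 1 U μ).groundStateFunctional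
        totalNumber).re / ((L + 1 : ℕ) : ℝ) ^ 2) atTop (𝓝 (1 - δ)) ∧
      Real.exp (-C / U ^ 2) ≤ dWaveOrderParameter U μ := by
  obtain ⟨U₀, c, hU₀, hc, hctl⟩ :=
    control_on_muWindow_of_fillings hleaf (μ₁ := -(21:ℝ) / 50) (μ₂ := -(7:ℝ) / 20) (by norm_num) (by norm_num)
      klwL_filling_ge klwU_filling_le
  obtain ⟨γ, hγ, hlead⟩ := r2dCert_leading_levelWindow hA hB hC
  have hlead' : ∀ U ∈ Set.Ioo (0:ℝ) 1, ∀ μ ∈ Set.Icc (-(21:ℝ) / 50) (-(7:ℝ) / 20), ∀ χ : D4Irrep,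
      χ ≠ D4Irrep.B1g → channelInf (squareDispersion 1 0) μ U D4Irrep.B1g + γ * U ^ 2 ≤
        channelInf (squareDispersion 1 0) μ U χ :=
    fun U hU μ hμ χ hχ => hlead U hU μ ⟨le_trans (by norm_num) hμ.1, hμ.2⟩ χ hχ
  have hfl := hBr (-(21:ℝ) / 50) (-(7:ℝ) / 20) γ 1 U₀ c (by norm_num) (by norm_num) (by norm_num) hγ one_pos hU₀ hc
    hctl hlead'
  exact rateKeepingCrux_of_shiftedWindowFloor (by norm_num) (by norm_num) le_rfl hfl

end Summit.HubbardSuperconductivity.HubbardSuperconductivity.Theorems.R2dH1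

end
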